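import Literature.NumberTheory.EllipticCurves.FormalGroupFrobeniusTypeAllPrimesProofs
import Literature.NumberTheory.EllipticCurves.HasseManin
import HarnessLib

/-!
# `a_p = 0`: multiplication by `p` on the reduced formal group is `[p]˜(X) = ĩ(X^{p²})`
# (exact height `2`, leading coefficient `−1`), and `a_p = 0` is automatic at a supersingular `p ≥ 5`

Topic `NumberTheory/EllipticCurves` (theorems only; no definition, no named fact, no instance).
For a Weierstrass equation `V/ℤ_p` with elliptic generic and special fibres and trace of Frobenius
`a = p + 1 − #Ṽ(𝔽_p) = 0`, the tree's Frobenius identity in the reduced formal group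
`F̃(X^{p²}, [p]˜(X)) = [a]˜(Xᵖ)` (`WeierstrassCurve.frobenius_formal_identity_of_nonneg'`, Manin's
`π² − aπ + p = 0` read on the formal point; Honda 1970 §6.2) becomes `F̃(X^{p²}, [p]˜(X)) = 0`, i.e. — in the
group `Ṽ(𝔽_p⸨X⸩)` of formal points (`laurentPt`, `laurentPt_formalGroupLaw'`, `neg_laurentPt`,
`laurentPt_injective`) — **`[p]˜(X) = ĩ(X^{p²})`** (`ĩ` the formal inverse): the classical statement
"`[p] = −φ²` on `Ê mod p` when `a_p = 0`", equivalently `[−p]˜(X) = X^{p²}`, which is the hypothesis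
`f ≡ X^q (mod π)` of Lubin–Tate's lemma for `(ℤ_{p²}, π = −p, q = p²)` (Serre 1972 §1.11: at a supersingular
prime with `a_p = 0` the formal group is a Lubin–Tate group of the unramified quadratic extension). In
particular the height is EXACTLY `2` with `[X^{p²}][p]˜ = −1` (the "exact height" left open in
`FormalGroupHeightTwoAtSupersingularPlaceProofs`). Finally, over `𝔽_p` with `p ≥ 5`, supersingular
(`p ∣ a`) forces `a = 0` by Hasse's bound `a² ≤ 4p` (tree `HasseManin.sq_le_four_mul`).

* `formalMul_prime_eq_formalNeg_subst_of_tr_eq_zero` — `[p]˜ = ĩ(X^{p²})` in `𝔽_p⟦X⟧`;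
* `coeff_sq_formalMul_prime_of_tr_eq_zero` — `[X^{p²}][p]˜ = −1`;
* `HasseManin.tr_eq_zero_of_dvd_of_five_le` — `#F = p ≥ 5`, `p ∣ a` ⇒ `a = 0`;
* `formalMul_prime_eq_formalNeg_subst_of_dvd_tr` — the two combined (`p ≥ 5`, `p ∣ a_p`).

## References
* [Honda1970] T. Honda, *On the theory of commutative formal groups*, J. Math. Soc. Japan 22 (1970), §6.2, Thm. 9.
* [Serre1972] J.-P. Serre, *Propriétés galoisiennes des points d'ordre fini des courbes elliptiques*,
  Invent. Math. 15 (1972), §1.11.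
* [SilvermanAEC2009] J. H. Silverman, *The Arithmetic of Elliptic Curves*, 2nd ed. (2009), IV.7.5, V.2.3.1,
  V.3.1(a), Thm. V.1.1, Ex. V.5.10.
-/

noncomputable section

open scoped Classical

namespace WeierstrassCurve

open scoped LaurentSeries
open PowerSeries Literature.NumberTheory.EllipticCurves

section FormalMul

variable {p : ℕ} [hp : Fact p.Prime] (V : WeierstrassCurve ℤ_[p]) [hE : (V.map PadicInt.Coe.ringHom).IsElliptic]
  [hEt : (V.map PadicInt.toZMod).IsElliptic]

/-- **`a_p = 0` ⟹ `[p]˜(X) = ĩ(X^{p²})` in `𝔽_p⟦X⟧`** ("`[p] = −φ²` on the reduced formal group"): from the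
Frobenius identity `F̃(X^{p²}, [p]˜X) = [a]˜(Xᵖ) = 0` read in the group of formal points `Ṽ(𝔽_p⸨X⸩)`,
`P(X^{p²}) + P([p]˜) = O`, so `P([p]˜) = −P(X^{p²}) = P(ĩ(X^{p²}))` and `σ ↦ P(σ)` is injective.
[cite: Honda1970, §6.2 Thm. 9] [cite: Serre1972, §1.11] [cite: SilvermanAEC2009, Thm. V.2.3.1(b)] -/
theorem formalMul_prime_eq_formalNeg_subst_of_tr_eq_zero
    (ha : Literature.NumberTheory.EllipticCurves.HasseManin.tr (V.map PadicInt.toZMod) = 0) :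
    (V.map PadicInt.toZMod).formalMul p =
      (V.map PadicInt.toZMod).formalNeg.subst ((PowerSeries.X : (ZMod p)⟦X⟧) ^ p ^ 2) := by
  have hp0 : p ≠ 0 := hp.out.ne_zero
  have hX : constantCoeff (PowerSeries.X : (ZMod p)⟦X⟧) = 0 := PowerSeries.constantCoeff_X
  have hXp : constantCoeff ((PowerSeries.X : (ZMod p)⟦X⟧) ^ p) = 0 := constantCoeff_pow_prime hX hp0
  have hXp2 : constantCoeff ((PowerSeries.X : (ZMod p)⟦X⟧) ^ p ^ 2) = 0 :=
    constantCoeff_pow_prime hX (pow_ne_zero 2 hp0)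
  have hmul0 : constantCoeff ((V.map PadicInt.toZMod).formalMul p) = 0 :=
    (V.map PadicInt.toZMod).constantCoeff_formalMul p
  -- the Frobenius identity with `a = 0`: `F̃(X^{p²}, [p]˜) = 0`
  have hfrob := V.frobenius_formal_identity_of_nonneg' (le_of_eq ha.symm)
  have h0sub : ((V.map PadicInt.toZMod).formalMul
      (Literature.NumberTheory.EllipticCurves.HasseManin.tr (V.map PadicInt.toZMod)).toNat).subst
        ((PowerSeries.X : (ZMod p)⟦X⟧) ^ p) = 0 := by
    rw [ha, Int.toNat_zero, formalMul_zero, ← PowerSeries.coe_substAlgHom (PowerSeries.HasSubst.of_constantCoeff_zero' hXp),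
      map_zero]
  rw [h0sub, PowerSeries.X_subst] at hfrob
  -- in the group of formal points: `P(X^{p²}) + P([p]˜) = P(F̃(X^{p²}, [p]˜)) = P(0) = O`
  have hsum := V.laurentPt_formalGroupLaw' PadicInt.toZMod hXp2 hmul0
  rw [laurentPt_congr hfrob _ (map_zero _), laurentPt_zero] at hsum
  -- `P([p]˜) = −P(X^{p²}) = P(ĩ(X^{p²}))`
  have hneg : (V.map PadicInt.toZMod).laurentPt ((V.map PadicInt.toZMod).formalMul p) hmul0 =
      (V.map PadicInt.toZMod).laurentPt ((V.map PadicInt.toZMod).formalNeg.subst ((PowerSeries.X : (ZMod p)⟦X⟧) ^ p ^ 2))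
        (constantCoeff_formalNeg_subst hXp2) := by
    rw [← neg_laurentPt hXp2]
    exact eq_neg_of_add_eq_zero_right hsum.symm
  exact laurentPt_injective hmul0 _ hneg

/-- `[Xⁿ] f(Xⁿ) = [X¹] f` for `n ≠ 0`. [folklore] -/
private theorem coeff_subst_X_pow_self {R : Type*} [CommRing R] (f : R⟦X⟧) {n : ℕ} (hn : n ≠ 0) :
    coeff n (f.subst ((PowerSeries.X : R⟦X⟧) ^ n)) = coeff 1 f := by
  have hs : HasSubst ((PowerSeries.X : R⟦X⟧) ^ n) := PowerSeries.HasSubst.X_pow hn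
  rw [coeff_subst' hs, finsum_eq_single _ 1]
  · rw [pow_one, coeff_X_pow, if_pos rfl, smul_eq_mul, mul_one]
  · intro d hd
    rw [← pow_mul, coeff_X_pow, if_neg, smul_zero]
    intro h
    rcases Nat.eq_zero_or_pos d with rfl | hdpos
    · rw [mul_zero] at h; exact hn h
    · have : n * 1 = n * d := by rw [mul_one]; exact h
      exact hd (Nat.eq_of_mul_eq_mul_left (Nat.pos_of_ne_zero hn) this).symm

/-- **Exact height `2` with leading coefficient `−1`**: `a_p = 0` ⟹ `[X^{p²}] [p]˜ = −1` in `𝔽_p`.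
[cite: SilvermanAEC2009, IV.7.5 and Thm. V.3.1(a)] [cite: Serre1972, §1.11] -/
theorem coeff_sq_formalMul_prime_of_tr_eq_zero
    (ha : Literature.NumberTheory.EllipticCurves.HasseManin.tr (V.map PadicInt.toZMod) = 0) :
    coeff (p ^ 2) ((V.map PadicInt.toZMod).formalMul p) = -1 := by
  rw [V.formalMul_prime_eq_formalNeg_subst_of_tr_eq_zero ha,
    coeff_subst_X_pow_self _ (pow_ne_zero 2 hp.out.ne_zero), coeff_one_formalNeg]

end FormalMul

end WeierstrassCurve

namespace Literature.NumberTheory.EllipticCurves.HasseManin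

/-- **At a supersingular prime `p ≥ 5` of a curve over `𝔽_p`, `a_p = 0`**: `p ∣ a` and Hasse's bound
`a² ≤ 4p < p²` force `a = 0`. [cite: SilvermanAEC2009, Thm. V.1.1 and Ex. V.5.10] -/
theorem tr_eq_zero_of_dvd_of_five_le {F : Type*} [Field F] [Fintype F] (W : WeierstrassCurve F) [W.IsElliptic]
    {p : ℕ} (hcard : Fintype.card F = p) (hp5 : 5 ≤ p) (hdvd : (p : ℤ) ∣ tr W) : tr W = 0 := by
  have hsq : (tr W) ^ 2 ≤ 4 * (Fintype.card F : ℤ) :=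
    sq_le_four_mul (fun n => dg_nonneg W n) (fun n hn => dg_succ_eq_one_of_dg_eq_zero W hn)
  rw [hcard] at hsq
  obtain ⟨m, hm⟩ := hdvd
  rw [hm] at hsq ⊢
  have hp0 : (0 : ℤ) < p := by exact_mod_cast (show 0 < p by omega)
  have hm2 : (p : ℤ) * m ^ 2 ≤ 4 := by nlinarith
  have hm0 : m = 0 := by
    by_contra h
    have : 1 ≤ m ^ 2 := by nlinarith [sq_nonneg m, Int.one_le_abs h, sq_abs m]
    nlinarith
  rw [hm0, mul_zero]

end Literature.NumberTheory.EllipticCurves.HasseManin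

namespace WeierstrassCurve

open PowerSeries Literature.NumberTheory.EllipticCurves

/-- **`p ≥ 5` supersingular ⟹ `[p]˜(X) = ĩ(X^{p²})`**: for `V/ℤ_p` with elliptic fibres and `p ∣ a_p`
(`p ≥ 5`), multiplication by `p` on the reduced formal group is the inverse of the `p²`-Frobenius.
[cite: Serre1972, §1.11] [cite: SilvermanAEC2009, Thm. V.2.3.1(b) and Ex. V.5.10] -/
theorem formalMul_prime_eq_formalNeg_subst_of_dvd_tr {p : ℕ} [hp : Fact p.Prime] (V : WeierstrassCurve ℤ_[p])
    [(V.map PadicInt.Coe.ringHom).IsElliptic] [(V.map PadicInt.toZMod).IsElliptic] (hp5 : 5 ≤ p)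
    (hdvd : (p : ℤ) ∣ Literature.NumberTheory.EllipticCurves.HasseManin.tr (V.map PadicInt.toZMod)) :
    (V.map PadicInt.toZMod).formalMul p =
      (V.map PadicInt.toZMod).formalNeg.subst ((PowerSeries.X : (ZMod p)⟦X⟧) ^ p ^ 2) :=
  V.formalMul_prime_eq_formalNeg_subst_of_tr_eq_zero
    (HasseManin.tr_eq_zero_of_dvd_of_five_le (V.map PadicInt.toZMod) (ZMod.card p) hp5 hdvd)


/-! ### Intrinsic form over `𝔽_p` (any elliptic curve over the prime field) -/

section PrimeField

variable {p : ℕ} [hp : Fact p.Prime]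

/-- Coefficientwise `ℤ_p`-lift of a Weierstrass equation over `𝔽_p`. [folklore] -/
private theorem exists_padicInt_lift' (E : WeierstrassCurve (ZMod p)) :
    ∃ V : WeierstrassCurve ℤ_[p], V.map PadicInt.toZMod = E := by
  refine ⟨⟨(E.a₁.val : ℤ_[p]), (E.a₂.val : ℤ_[p]), (E.a₃.val : ℤ_[p]), (E.a₄.val : ℤ_[p]), (E.a₆.val : ℤ_[p])⟩, ?_⟩
  ext <;> simp [WeierstrassCurve.map]

/-- The `ℤ_p`-lift of an elliptic curve over `𝔽_p` has elliptic generic fibre (`Δ` is a `p`-adic unit).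
[cite: SilvermanAEC2009, VII.5.1] -/
private theorem isElliptic_map_coe_of_lift (V : WeierstrassCurve ℤ_[p]) [hV : (V.map PadicInt.toZMod).IsElliptic] :
    (V.map PadicInt.Coe.ringHom).IsElliptic := by
  refine ⟨?_⟩
  rw [WeierstrassCurve.map_Δ, isUnit_iff_ne_zero]
  intro h0
  have hΔ : V.Δ = 0 := (PadicInt.coe_eq_zero (p := p)).mp h0
  have h := hV.isUnit
  rw [WeierstrassCurve.map_Δ, hΔ, map_zero] at h
  exact not_isUnit_zero h

/-- **Every elliptic curve `E/𝔽_p` with `a_p = 0` has `[p](X) = i(X^{p²})` in its formal group** (intrinsic form of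
`formalMul_prime_eq_formalNeg_subst_of_tr_eq_zero`: lift `E` coefficientwise to `ℤ_p`; the formal group law of `E` is
that of the lift reduced mod `p`). [cite: Serre1972, §1.11] [cite: SilvermanAEC2009, Thm. V.2.3.1(b)] -/
theorem formalMul_ringChar_eq_formalNeg_subst_of_tr_eq_zero (E : WeierstrassCurve (ZMod p)) [E.IsElliptic]
    (ha : Literature.NumberTheory.EllipticCurves.HasseManin.tr E = 0) :
    E.formalMul p = E.formalNeg.subst ((PowerSeries.X : (ZMod p)⟦X⟧) ^ p ^ 2) := by
  obtain ⟨V, rfl⟩ := exists_padicInt_lift' E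
  haveI := isElliptic_map_coe_of_lift V
  exact V.formalMul_prime_eq_formalNeg_subst_of_tr_eq_zero ha

/-- **Every supersingular elliptic curve `E/𝔽_p`, `p ≥ 5`, has `[p](X) = i(X^{p²})` in its formal group** (`p ∣ a_p`
forces `a_p = 0`). [cite: Serre1972, §1.11] [cite: SilvermanAEC2009, Ex. V.5.10] -/
theorem formalMul_ringChar_eq_formalNeg_subst_of_dvd_tr (E : WeierstrassCurve (ZMod p)) [E.IsElliptic] (hp5 : 5 ≤ p)
    (hdvd : (p : ℤ) ∣ Literature.NumberTheory.EllipticCurves.HasseManin.tr E) :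
    E.formalMul p = E.formalNeg.subst ((PowerSeries.X : (ZMod p)⟦X⟧) ^ p ^ 2) :=
  E.formalMul_ringChar_eq_formalNeg_subst_of_tr_eq_zero (HasseManin.tr_eq_zero_of_dvd_of_five_le E (ZMod.card p) hp5 hdvd)

/-- **Exact height `2` for every elliptic `E/𝔽_p` with `a_p = 0`**: `[X^{p²}][p] = −1`. [cite: SilvermanAEC2009, IV.7.5] -/
theorem coeff_sq_formalMul_ringChar_of_tr_eq_zero (E : WeierstrassCurve (ZMod p)) [E.IsElliptic]
    (ha : Literature.NumberTheory.EllipticCurves.HasseManin.tr E = 0) :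
    coeff (p ^ 2) (E.formalMul p) = -1 := by
  obtain ⟨V, rfl⟩ := exists_padicInt_lift' E
  haveI := isElliptic_map_coe_of_lift V
  exact V.coeff_sq_formalMul_prime_of_tr_eq_zero ha

end PrimeField

end WeierstrassCurve

end
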